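import Literature.NumberTheory.GaloisRepresentations.NearlyOrdinaryPresentationProofs
import Literature.AlgebraicGeometry.Resolution.RegularLocalRingsUFD
import Summits.BirchSwinnertonDyer.BirchSwinnertonDyer.Theorems.ResidualThetaTransportAtTwoPollackPairKUnique

/-! Scratch of stub-critic g2 (STUB-PLAN rev 2 §3 A2) for crux (R≥)ᵖ stmt-BirchSwinnertonDyer-26074, stub `stub_cmLambdaLower` = RSL_g 22608:
the one-variable UFD / regularity of `Λ_𝒪 = 𝒪⟦T⟧` that k2-H2 `FinrankMonoOfLengthLe` needs, assembled from TREE THEOREMS ONLY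
(no definition, no named fact, no instance, no sorry). Not a Theorems file; a prover may move these three decls into
`Theorems/ResidualThetaTransportAtTwoLambdaLowerBoundOLength.lean`. BSD is not proved by any of this. -/

open Literature.NumberTheory.GaloisRepresentations Literature.AlgebraicGeometry.Resolution

universe u

/-- `𝒪⟦T⟧` is a regular local ring for a DVR `𝒪` (it is `𝒪⟦X₀⟧`, regular of dimension 2). -/
theorem isRegularLocalRing_powerSeries_dvr (𝒪 : Type u) [CommRing 𝒪] [IsDomain 𝒪]
    [IsDiscreteValuationRing 𝒪] : IsRegularLocalRing (PowerSeries 𝒪) :=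
  haveI := NearlyOrdinaryPresentationCA.isRegularLocalRing_mvPowerSeries_dvr 𝒪 1
  IsRegularLocalRing.of_ringEquiv (MvPowerSeries.renameEquiv 𝒪 finOneEquiv.symm).toRingEquiv.symm

/-- `𝒪⟦T⟧` is factorial for a DVR `𝒪` (regular local of dimension 2, Auslander–Buchsbaum). -/
theorem uniqueFactorizationMonoid_powerSeries_dvr (𝒪 : Type u) [CommRing 𝒪] [IsDomain 𝒪]
    [IsDiscreteValuationRing 𝒪] : UniqueFactorizationMonoid (PowerSeries 𝒪) :=
  uniqueFactorizationMonoid_of_isRegularLocalRing _ (isRegularLocalRing_powerSeries_dvr 𝒪)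

open Literature.NumberTheory.EllipticCurves in
/-- `Λ_𝒪 = 𝒪⟦T⟧` with `𝒪 = padicCoeffIntegers S` is factorial (for `ℚ_p(S)/ℚ_p` finite). -/
theorem uniqueFactorizationMonoid_iwasawaAlgebraO {p : ℕ} [Fact p.Prime] (S : Set (PadicAlgCl p))
    [FiniteDimensional ℚ_[p] (padicCoeffField S)] :
    UniqueFactorizationMonoid (IwasawaAlgebraO S) := by
  haveI : IsDiscreteValuationRing (padicCoeffIntegers S) :=
    Summit.BirchSwinnertonDyer.BirchSwinnertonDyer.Theorems.PollackPairK.isDiscreteValuationRing_padicCoeffIntegers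
  exact uniqueFactorizationMonoid_powerSeries_dvr _
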